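import Summits.BirchSwinnertonDyer.BirchSwinnertonDyer.Theorems.GenusKolyvaginAtTwoGenusPrimitiveSupplyAtTwoPrimeTwistStrata
import HarnessLib

/-!
# Route `GenusKolyvaginAtTwo`, crux #2 `GenusPrimitiveSupplyAtTwo` (stmt-BirchSwinnertonDyer-22136):
# THE HYPOTHESIS-FREE `Δ > 0` LATTICE of the prime-twist dictionary — `Sel₂^{str ∞} ≤ {Sel₂(W), Sel_𝔓(A_χ)} ≤ Sel₂^{rel ∞}`, index `2`,
# `Sel₂(W) ⊓ Sel_𝔓(A_χ) = Sel₂^{str ∞}` — and the reduction of U′ `OddBranchShaIndexTwoInTwistSelmerAtTwo` to the Selmer egg bit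

Width seat `bsd-line-gk2-p5` g14 (cell `bsd-f1-sign2`, SUPPLY lineage of crux 22136), file 38 of the series; sequel of files 34–36
(`…PrimeTwistSandwich`, `…PrimeTwistRealPlace`, `…PrimeTwistStrata`). THEOREMS ONLY (no definition, no named fact, no `sorry`); helper
`--supports stmt-BirchSwinnertonDyer-22136`; no item is closed; BSD is not proved by any of this.

WHAT. For an elliptic `W/ℚ` with `Δ_W > 0`, a descent-admissible `d` and its character `χ`, inside `H¹(ℚ, E[2])` (no `E(ℚ)[2] = 0`, no `Ш[2] = 0`,
no egg hypothesis):
* §170 `eq_or_eq_of_relIndex_eq_two` — a subgroup squeezed in an index-`2` pair is one of the two ends.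
* §171 **`selmerGroup_eq_kummerStrict_or_eq_relaxed_of_Δ_pos`**, **`primeTwist_selmerGroup_eq_kummerStrict_or_eq_relaxed_of_Δ_pos`** — both `Sel₂(W)`
  and `Sel_𝔓(A_χ/ℚ)` are `Sel₂^{str ∞}(W)` or `Sel₂^{rel ∞}(W)` (`[rel : str] = #𝓛_∞ = 2`), and they MEET in `Sel₂^{str ∞}(W)` (file 35); hence
  **`primeTwist_selmerGroup_eq_kummerStrict_of_relaxed_le_selmerGroup`**: «Selmer egg bit `1` (some `Sel₂`-class non-trivial at `∞`) ⟹ DOWN: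
  `Sel_𝔓(A_χ) = Sel₂^{str ∞}(W)`, `2·#Sel_𝔓(A_χ) = #Sel₂(W)`» — the egg DOWN law with the RATIONAL egg point replaced by a SELMER class (as on
  the odd branch, where `Sel₂(W) = Ш(W)[2]`).
* §172 **`selmerGroup_le_primeTwist_selmerGroup_iff_forall_localization_eq_zero`** — `Sel₂(W) ≤ Sel_𝔓(A_χ) ↔` every `Sel₂`-class is trivial at `∞`;
  **`selmerGroup_le_and_relIndex_eq_two_iff`** — U′'s conclusion «`Sel₂(W) ≤ Sel_𝔓(A_χ)` with index `2`» ⟺ «Selmer egg bit `0` AND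
  `Sel_𝔓(A_χ) = Sel₂^{rel ∞}(W)`» (the UP branch); so U′ `OddBranchShaIndexTwoInTwistSelmerAtTwo` = (egg bit `0` on the odd branch) + (Kramer's
  parity / the model count `#Sel₂(W^{(d)}) = 8` transported), neither of which is claimed here.

Honest framing: KNOWN in print (MR 2010 Lemma 3.2 / Prop. 3.3; Kramer 1981 Thm. 1, Prop. 6–7); kernel-new bookkeeping; beyond-print theorem: no.
Crux 22136 stays OPEN exactly at (U) 24947 ∧ (CONV₂) 19220/24948. BSD is not proved by any of this.

References: [MazurRubin2010] Def. 3.1, Lemma 3.2, Prop. 3.3; [Kramer1981] Thm. 1, Prop. 6, Prop. 7; [MazurRubin2007] Prop. 5.2.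
-/

set_option linter.dupNamespace false -- tree convention: `Summit.BirchSwinnertonDyer.BirchSwinnertonDyer.Theorems` (summit = sub-problem)
set_option autoImplicit false

noncomputable section

open scoped Classical

namespace Summit.BirchSwinnertonDyer.BirchSwinnertonDyer.Theorems.GenusKolyArch

open WeierstrassCurve Field NumberField IsDedekindDomain Function
open Literature.NumberTheory.EllipticCurves Literature.NumberTheory.GaloisRepresentations
open Literature.NumberTheory.GaloisCohomology
open Summit.BirchSwinnertonDyer.Rank1Residual.X11b.KummerPT (kummerStrict kummerRelaxed)
open Summit.BirchSwinnertonDyer.Rank1Residual.F1Sign2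

/-! ## §170 Index two leaves no room -/

/-- **A subgroup squeezed between an index-`2` pair is one of the two ends.** [folklore] -/
theorem eq_or_eq_of_relIndex_eq_two {G : Type*} [AddGroup G] {A B C : AddSubgroup G} (hAB : A ≤ B) (hBC : B ≤ C)
    (h : A.relIndex C = 2) : B = A ∨ B = C := by
  have hmul := AddSubgroup.relIndex_mul_relIndex _ _ _ hAB hBC
  rw [h] at hmul
  have hdvd : A.relIndex B ∣ 2 := ⟨_, hmul.symm⟩
  rcases (Nat.dvd_prime Nat.prime_two).mp hdvd with ha | ha
  · exact Or.inl (le_antisymm (AddSubgroup.relIndex_eq_one.mp ha) hAB)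
  · rw [ha] at hmul
    have hb : B.relIndex C = 1 := by omega
    exact Or.inr (le_antisymm hBC (AddSubgroup.relIndex_eq_one.mp hb))

/-! ## §171 The `Δ > 0` lattice -/

section Lattice

variable (W : WeierstrassCurve ℚ) [W.IsElliptic] {d : ℤ} {χ : absoluteGaloisGroup ℚ →ₜ* Multiplicative (ZMod 2)}

/-- **`Δ_W > 0`: `Sel₂(W)` is `Sel₂^{str ∞}(W)` or `Sel₂^{rel ∞}(W)`** (`[rel : str] = #𝓛_∞ = 2`, files 16–17; no further hypothesis).
[cite: MazurRubin2010, Lemma 3.2] [cite: Kramer1981, Prop. 6] -/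
theorem selmerGroup_eq_kummerStrict_or_eq_relaxed_of_Δ_pos (hΔ : 0 < W.Δ) (w : InfinitePlace ℚ) :
    W.selmerGroup ((2 : ℕ) : ℤ) = (kummerStrict W 2 {(Sum.inl w : Place ℚ)}).selmerGroup ∨
      W.selmerGroup ((2 : ℕ) : ℤ) = selmerGroupRelaxedAtInfinityAtTwo W :=
  eq_or_eq_of_relIndex_eq_two (selmerGroup_kummerStrict_singleton_inl_le_selmerGroup W w)
    (selmerGroup_le_selmerGroupRelaxedAtInfinityAtTwo W) (relIndex_kummerStrict_selmerGroupRelaxedAtInfinityAtTwo_eq_two_of_Δ_pos W hΔ w)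

variable [W.IsGloballyMinimal]

/-- **`Δ_W > 0`, `d` descent-admissible: `Sel_𝔓(A_χ/ℚ)` is `Sel₂^{str ∞}(W)` or `Sel₂^{rel ∞}(W)`** (the sandwich of file 34 inside an index-`2` pair).
[cite: MazurRubin2010, Lemma 3.2 and Prop. 3.3] -/
theorem primeTwist_selmerGroup_eq_kummerStrict_or_eq_relaxed_of_Δ_pos (hΔ : 0 < W.Δ) (hd : DescAdmissible W d)
    (hχ : IsQuadraticCharacterOf χ d) (w : InfinitePlace ℚ) :
    PrimeTwist.selmerGroup W χ = (kummerStrict W 2 {(Sum.inl w : Place ℚ)}).selmerGroup ∨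
      PrimeTwist.selmerGroup W χ = selmerGroupRelaxedAtInfinityAtTwo W :=
  eq_or_eq_of_relIndex_eq_two (selmerGroup_kummerStrict_le_primeTwist_selmerGroup W hd hχ w)
    (primeTwist_selmerGroup_le_selmerGroupRelaxedAtInfinityAtTwo W hd hχ)
    (relIndex_kummerStrict_selmerGroupRelaxedAtInfinityAtTwo_eq_two_of_Δ_pos W hΔ w)

/-- **Selmer egg bit `1` ⟹ DOWN: if `Sel₂^{rel ∞}(W) ≤ Sel₂(W)` (some — hence every non-strict — real localisation is hit by `Sel₂(W)`), then
`Sel_𝔓(A_χ/ℚ) = Sel₂^{str ∞}(W)`** for every descent-admissible `d` (no sign, torsion, `Ш` or rational-egg-point hypothesis): `Sel_𝔓 ≤ rel = Sel₂` and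
`Sel₂ ⊓ Sel_𝔓 = str` (file 35). [cite: MazurRubin2010, Lemma 3.2 and Prop. 3.3] [cite: Kramer1981, Prop. 7] -/
theorem primeTwist_selmerGroup_eq_kummerStrict_of_relaxed_le_selmerGroup (hd : DescAdmissible W d) (hχ : IsQuadraticCharacterOf χ d)
    (w : InfinitePlace ℚ) (hR : selmerGroupRelaxedAtInfinityAtTwo W ≤ W.selmerGroup ((2 : ℕ) : ℤ)) :
    PrimeTwist.selmerGroup W χ = (kummerStrict W 2 {(Sum.inl w : Place ℚ)}).selmerGroup := by
  rw [← selmerGroup_inf_primeTwist_selmerGroup_eq_kummerStrict W hd hχ w]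
  exact (inf_eq_right.mpr ((primeTwist_selmerGroup_le_selmerGroupRelaxedAtInfinityAtTwo W hd hχ).trans hR)).symm

/-- **Selmer egg bit `1` ⟹ `2 · #Sel_𝔓(A_χ/ℚ) = #Sel₂(W)`** (`Δ_W > 0`; the DOWN law of file 36 with the rational egg point replaced by the
hypothesis `Sel₂^{rel ∞}(W) ≤ Sel₂(W)`, e.g. a `Ш[2]`-class non-trivial at `∞`). [cite: Kramer1981, Thm. 1] [cite: MazurRubin2010, Prop. 3.3] -/
theorem two_mul_natCard_primeTwist_selmerGroup_eq_of_relaxed_le_selmerGroup (hΔ : 0 < W.Δ) (hd : DescAdmissible W d)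
    (hχ : IsQuadraticCharacterOf χ d) (hR : selmerGroupRelaxedAtInfinityAtTwo W ≤ W.selmerGroup ((2 : ℕ) : ℤ)) :
    2 * Nat.card (PrimeTwist.selmerGroup W χ) = selmerTwoCard W := by
  have hSel : W.selmerGroup ((2 : ℕ) : ℤ) = selmerGroupRelaxedAtInfinityAtTwo W :=
    le_antisymm (selmerGroup_le_selmerGroupRelaxedAtInfinityAtTwo W) hR
  have h := natCard_mul_relIndex_eq_natCard
    ((selmerGroup_kummerStrict_singleton_inl_le_selmerGroup W Rat.infinitePlace).trans
      (selmerGroup_le_selmerGroupRelaxedAtInfinityAtTwo W))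
  rw [relIndex_kummerStrict_selmerGroupRelaxedAtInfinityAtTwo_eq_two_of_Δ_pos W hΔ Rat.infinitePlace,
    ← primeTwist_selmerGroup_eq_kummerStrict_of_relaxed_le_selmerGroup W hd hχ Rat.infinitePlace hR, ← hSel] at h
  rw [mul_comm]
  exact h

/-! ## §172 `Sel₂(W) ≤ Sel_𝔓(A_χ)` is the Selmer egg bit; U′'s conclusion unfolded -/

/-- **`Sel₂(W) ≤ Sel_𝔓(A_χ/ℚ) ↔` every `2`-Selmer class of `W` is trivial at `∞`** (descent-admissible `d`; any sign of `Δ`): `→` because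
`Sel₂ ⊓ Sel_𝔓 = Sel₂^{str ∞}` (file 35), `←` because then `Sel₂ = Sel₂^{str ∞} ≤ Sel_𝔓` (file 34). [cite: MazurRubin2010, Lemma 3.2] [cite: Kramer1981, Prop. 7] -/
theorem selmerGroup_le_primeTwist_selmerGroup_iff_forall_localization_eq_zero (hd : DescAdmissible W d) (hχ : IsQuadraticCharacterOf χ d)
    (w : InfinitePlace ℚ) :
    W.selmerGroup ((2 : ℕ) : ℤ) ≤ PrimeTwist.selmerGroup W χ ↔
      ∀ c ∈ W.selmerGroup ((2 : ℕ) : ℤ), galoisCohomology.localization (W.torsionGaloisModule ((2 : ℕ) : ℤ)) (Sum.inl w) 1 c = 0 := by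
  constructor
  · intro hle c hc
    have hc' : c ∈ (kummerStrict W 2 {(Sum.inl w : Place ℚ)}).selmerGroup := by
      rw [← selmerGroup_inf_primeTwist_selmerGroup_eq_kummerStrict W hd hχ w]
      exact AddSubgroup.mem_inf.mpr ⟨hc, hle hc⟩
    exact ((mem_selmerGroup_kummerStrict_singleton_inl_iff W w c).mp hc').2
  · intro hall
    rw [selmerGroup_eq_selmerGroup_kummerStrict_of_forall_localization_eq_zero W w hall]
    exact selmerGroup_kummerStrict_le_primeTwist_selmerGroup W hd hχ w

/-- **U′'s conclusion unfolded** (`Δ_W > 0`, `d` descent-admissible): «`Sel₂(W) ≤ Sel_𝔓(A_χ/ℚ)` of index `2`» holds iff «every `Sel₂`-class is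
trivial at `∞`» AND «`Sel_𝔓(A_χ/ℚ) = Sel₂^{rel ∞}(W)`» (the UP branch of the lattice). So `OddBranchShaIndexTwoInTwistSelmerAtTwo` is exactly
(Selmer egg bit `0` on the odd branch) + (the UP decision, i.e. Kramer's parity / the model count `#Sel₂(W^{(d)}) = 8` transported to
`Sel_𝔓(A_χ)`), neither claimed here. [cite: MazurRubin2010, Lemma 3.2 and Prop. 3.3] [cite: Kramer1981, Thm. 1] -/
theorem selmerGroup_le_and_relIndex_eq_two_iff (hΔ : 0 < W.Δ) (hd : DescAdmissible W d) (hχ : IsQuadraticCharacterOf χ d)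
    (w : InfinitePlace ℚ) :
    (W.selmerGroup ((2 : ℕ) : ℤ) ≤ PrimeTwist.selmerGroup W χ ∧ (W.selmerGroup ((2 : ℕ) : ℤ)).relIndex (PrimeTwist.selmerGroup W χ) = 2) ↔
      ((∀ c ∈ W.selmerGroup ((2 : ℕ) : ℤ), galoisCohomology.localization (W.torsionGaloisModule ((2 : ℕ) : ℤ)) (Sum.inl w) 1 c = 0) ∧
        PrimeTwist.selmerGroup W χ = selmerGroupRelaxedAtInfinityAtTwo W) := by
  have h2 := relIndex_kummerStrict_selmerGroupRelaxedAtInfinityAtTwo_eq_two_of_Δ_pos W hΔ w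
  constructor
  · rintro ⟨hle, hidx⟩
    have hall := (selmerGroup_le_primeTwist_selmerGroup_iff_forall_localization_eq_zero W hd hχ w).mp hle
    have hSel := selmerGroup_eq_selmerGroup_kummerStrict_of_forall_localization_eq_zero W w hall
    refine ⟨hall, ?_⟩
    rcases primeTwist_selmerGroup_eq_kummerStrict_or_eq_relaxed_of_Δ_pos W hΔ hd hχ w with h | h
    · exfalso
      rw [h, ← hSel, AddSubgroup.relIndex_self] at hidx
      exact absurd hidx (by norm_num)
    · exact h
  · rintro ⟨hall, hP⟩
    have hSel := selmerGroup_eq_selmerGroup_kummerStrict_of_forall_localization_eq_zero W w hall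
    refine ⟨?_, ?_⟩
    · rw [hSel]; exact selmerGroup_kummerStrict_le_primeTwist_selmerGroup W hd hχ w
    · rw [hSel, hP]; exact h2

/-- **Selmer egg bit `0` ⟹ the UP dichotomy: `Sel_𝔓(A_χ/ℚ) = Sel₂(W)` or `Sel_𝔓(A_χ/ℚ) = Sel₂^{rel ∞}(W) ⊋ Sel₂(W)`** with
`#Sel_𝔓(A_χ) ∈ {#Sel₂(W), 2·#Sel₂(W)}` (`Δ_W > 0`, `d` descent-admissible; file 36's dichotomy without the `E(ℚ)[2] = 0`, `Ш[2] = 0` hypotheses).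
[cite: MazurRubin2010, Lemma 3.2 and Prop. 3.3] [cite: Kramer1981, Thm. 1] -/
theorem primeTwist_selmerGroup_eq_or_eq_of_forall_localization_eq_zero (hΔ : 0 < W.Δ) (hd : DescAdmissible W d)
    (hχ : IsQuadraticCharacterOf χ d) (w : InfinitePlace ℚ)
    (hall : ∀ c ∈ W.selmerGroup ((2 : ℕ) : ℤ), galoisCohomology.localization (W.torsionGaloisModule ((2 : ℕ) : ℤ)) (Sum.inl w) 1 c = 0) :
    (PrimeTwist.selmerGroup W χ = W.selmerGroup ((2 : ℕ) : ℤ) ∨ PrimeTwist.selmerGroup W χ = selmerGroupRelaxedAtInfinityAtTwo W) ∧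
      (Nat.card (PrimeTwist.selmerGroup W χ) = selmerTwoCard W ∨ Nat.card (PrimeTwist.selmerGroup W χ) = 2 * selmerTwoCard W) := by
  have hSel := selmerGroup_eq_selmerGroup_kummerStrict_of_forall_localization_eq_zero W w hall
  have hR : Nat.card (selmerGroupRelaxedAtInfinityAtTwo W) = 2 * selmerTwoCard W := by
    rw [natCard_selmerGroupRelaxedAtInfinityAtTwo_eq_mul W,
      (relIndex_selmerGroup_selmerGroupRelaxedAtInfinityAtTwo_eq_two_iff_of_Δ_pos W hΔ w).mpr hall, mul_comm]
  rcases primeTwist_selmerGroup_eq_kummerStrict_or_eq_relaxed_of_Δ_pos W hΔ hd hχ w with h | h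
  · rw [← hSel] at h
    exact ⟨Or.inl h, Or.inl (by rw [h]; rfl)⟩
  · exact ⟨Or.inr h, Or.inr (by rw [h, hR])⟩

end Lattice

end Summit.BirchSwinnertonDyer.BirchSwinnertonDyer.Theorems.GenusKolyArch

end
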